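import Summits.CriticalPhenomena.PercolationContinuityZ3.Theorems.Transplant.SkelFrmBParamsFaceUnits
import Summits.CriticalPhenomena.PercolationContinuityZ3.Theorems.Transplant.PlanarCells2TDefs
import Summits.CriticalPhenomena.PercolationContinuityZ3.Theorems.Transplant.SkelPhiFaceNumsCross
import Summits.CriticalPhenomena.PercolationContinuityZ3.Theorems.Transplant.SkelNegBParamsFaceCountsA
import Summits.CriticalPhenomena.PercolationContinuityZ3.Theorems.Transplant.PlanarSkeletonFrmDefs
import Summits.CriticalPhenomena.PercolationContinuityZ3.Theorems.Transplant.SkelPhiStepIDataNS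
import HarnessLib
/-!
(F) VALUE LAYER, N2 twin (hp-8 g42, 2026-08-23; F-DISCHARGE-MAP-N2 G18 x-face counts, delta (Δ1)/(R-22)): `port_frm.py` text of N1 `SkelNegBParamsFaceCountsA` (p3-g12)
with the counts stated over a GENERIC STAGGERED cell family `(P : PCells2T)` (PlanarCells2TDefs; at the node `P := fcellsT …`, stmt-g21) and the units/readings of
`SkelFrmBParamsFaceUnits` (p1-g17 p356824: `u₀A/u₁A/FcA/F1cA/Λ₀of`, 6-conjunct `units_eqA`). THE ONE GEOMETRIC DELTA: the x-face's TRANSVERSE TARGET is the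
STAGGERED neighbour centre — `T1X P x du z := P.cenS (x + stepVec du) 1 − z 1 = P.cenS x 1 + sgOf du·c 0 − z 1` (`cenS_step_one`; N1 `cen x 1 − z 1` had no creep and would
miss the window `BSlot.small 1 = 8·s₁` by `c 0 ≤ K·s₁`), so `T1X/σTX/N3X/N3X_spec` take the step `du`; `T0X P x du z := P.cenS (x + stepVec du) 0 − z 0` and `T0X_eq :
σ·T0X = 20·r₀ − lev` are verbatim over `PCells2T.cenS_add_stepVec_fst`; `T0X/T1X/T0X_eq` depend on the cells only (binders `(P : PCells2T)`), the counts `σTX/N3X/yTX0/NrX`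
and `FcA_add_stride/crossOffX_eq/FcA_crossOffX/N3X_spec/NrX_spec` keep the slot binders `κ Φ t p D g f` (+ `P`). `round_count` is N1's (cell-free, not re-declared);
`RootArith.floor_sandwich` by N1 FQN. Everything else verbatim.
NON-VACUITY: closed-form definitions + their rounding lemmas; no hypothesis rows beyond `EqNumL`.
builds on p205010 (kernel theorem, internal audit signed; external expert review pending); nothing here is a claim about the open node `SamePDropOfSkeletonFrm₁`.
N1 HEADER (kept for the reader):
# N1 params, M3 (the (F) per-centre floors at the (ζ′) tuple), part 0 — **THE x-FACE RUN COUNTS**: the tangential sign `σTX`, the tangential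
# count `N3X`, the cross-shifted along origin `yTX0` and the along count `NrX` of an x-face centre, as CLOSED TERMS of (landing origin `yL`,
# arrival data `x du`, contact point `z`), with their exact-shift and rounding lemmas
(p3-g12, design owner / M3 pen, 2026-08-22; spec HOME prim-hp-8/M3-FLOORS-SIGNATURE.md §2 'degrees of freedom', F-COLUMN-N1-PLAN ADDENDUM 6 `NrF`).

The x-face route of a contact at `z` (arrival `(x, du)`, `du.1 = 0`, run sign `σ = sgOf du`): bridge → along x-run of `Nr + 1` strides `u = (n_L, h_L)`
from the landing origin `yL` → tangential y′-run of `N₃ + 1` regions → last core in the arrival box centred at `cen (x + e_du)`.  Readings through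
`prFA` (all projections `rfl`, stmt-g16 2026-08-22T06:09:47Z) are `KS.FcA` (axis 0, `= (2u₀Λ₀ + m)/(2m)`, RootValsA) and `KS.F1cA` (axis 1, RootValsYA).
* `T0X x du z := cen (x + stepVec du) 0 − z 0` (`σ·T0X = 20r₀ − lev du x z`, `T0X_eq`), `T1X x z := cen x 1 − z 1` — the arrival targets relative to the contact;
* `σTX yL x z := if F1cA yL ≤ T1X then 1 else −1`; `N3X yL x z := toNat((|T1X − F1cA yL| + u₁/2)/u₁ − 1)`;
* `yTX0 yL σT := yL + pt (σT·v_L) (σT·h_L·v_L/n_L)` (the cross shift of `Skelφ.crossOffX` at zero strides) and the EXACT SHIFT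
  `FcA (yL + crossOffX n_L h_L v_L σ σT Nr) = FcA (yTX0 yL σT) + σ·u₀·(Nr+1)` (`FcA_crossOffX`; one `u`-stride adds `m` to `Λ₀`, `u₀` to the reading);
* `NrX yL σT x du z := toNat((σ·(T0X − FcA (yTX0 yL σT)) + u₀/2)/u₀ − 1)` with `NrX_spec`: if the target is at least one stride ahead
  (`u₀ ≤ σ·(T0X − FcA (yTX0 …))`) then `|FcA(yTX0) + σ·u₀·(NrX+1) − T0X| ≤ u₀` and `u₀·(NrX + 1) ≤ σ·(T0X − FcA(yTX0)) + u₀`;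
* `N3X_spec`: `σTX = ±1`, `u₁·(N3X + 1) ≤ |T1X − F1cA yL| + 2u₁`, and `|F1cA yL + σTX·u₁·(N3X+1) − T1X| ≤ u₁`.
builds on p205010 (kernel theorem, internal audit signed; external expert review pending) — nothing in this file uses p205010; NOTHING is claimed about the node
`SamePDropOfSkeletonNeg₁` (OPEN); values + arithmetic only.
Lane `prim-bschramm-*`, seat `prim-bschramm-p3` (gen 12); helper file (`--supports stmt-CriticalPhenomena-4575 --as helper`).
[cite: KozmaNitzan2024, §4 Lemma 11 (p. 22), Lemma 12 (pp. 23–25)] [cite: MartineauTassion2017, §4.1]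
-/

noncomputable section

open scoped Classical

namespace Summit.CriticalPhenomena.PercolationContinuityZ3.Theorems.Transplant

namespace PlanarSkeletonFrm

namespace NegB

open Literature.Probability.Percolation Literature.Probability.LatticeModels SimpleGraph
open Literature.Probability.Percolation.KozmaNitzan.Cells (oth sgOf sgOf_sign stepVec_apply_fst stepVec_apply_oth)
open SkelConc (Consts)
open Skelφ.StepI (DataN)
open TwoAxis.Para (modulus)
open Neg

namespace KS

section FaceCounts

/-- **The along target of an x-face contact**: the arrival box centre minus the contact point, axis `0`. [this work] -/
def T0X (P : PCells2T) (x : Site 2) (du : MDir) (z : Site 2) : ℤ := P.cenS (x + stepVec du) 0 - z 0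

/-- **The transverse target of an x-face contact**: the arrival cell's STAGGERED centre minus the contact point, axis `1` (N2 (R-22): `cenS (x + e_du) 1 = cenS x 1 + σ·c 0`,
so the tangential run aims at the creep-shifted centre — delta vs N1's `cen x 1 − z 1`). [this work] -/
def T1X (P : PCells2T) (x : Site 2) (du : MDir) (z : Site 2) : ℤ := P.cenS (x + stepVec du) 1 - z 1

/-- **The tangential sign**: towards the transverse target from the landing origin's ordinate reading. [this work] -/
def σTX (κ : Consts) {V : Type} [DecidableEq V] [Countable V] {G : SimpleGraph V} [G.LocallyFinite] (Φ : PlanarSkeletonFrm G) (t : V) (p : unitInterval) (D : Skelφ.StepI.DataNS V) (g : ℕ) (f : ℕ) (P : PCells2T) (yL x : Site 2) (du : MDir) (z : Site 2) : ℤ := if F1cA κ Φ t p D g f yL ≤ T1X P x du z then 1 else -1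

/-- **The tangential count** `N3X := round(|T1X − F1cA yL|/u₁) − 1` (clipped at `0`). [this work] -/
def N3X (κ : Consts) {V : Type} [DecidableEq V] [Countable V] {G : SimpleGraph V} [G.LocallyFinite] (Φ : PlanarSkeletonFrm G) (t : V) (p : unitInterval) (D : Skelφ.StepI.DataNS V) (g : ℕ) (f : ℕ) (P : PCells2T) (yL x : Site 2) (du : MDir) (z : Site 2) : ℕ :=
  Int.toNat ((|T1X P x du z - F1cA κ Φ t p D g f yL| + u₁A κ Φ t p D g f / 2) / u₁A κ Φ t p D g f - 1)

/-- **The cross-shifted along origin** `yL + (σT·v_L, σT·h_L·v_L/n_L)` (`Skelφ.crossOffX` at zero strides). [this work] -/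
def yTX0 (κ : Consts) {V : Type} [DecidableEq V] [Countable V] {G : SimpleGraph V} [G.LocallyFinite] (Φ : PlanarSkeletonFrm G) (t : V) (p : unitInterval) (D : Skelφ.StepI.DataNS V) (g : ℕ) (f : ℕ) (yL : Site 2) (σT : ℤ) : Site 2 :=
  yL + Skelφ.pt (σT * vL κ Φ t p D g f) (σT * hL κ Φ t p D g f * vL κ Φ t p D g f / (nL κ Φ t p D g f : ℤ))

/-- **The along count** `NrX := round(σ·(T0X − FcA(yTX0))/u₀) − 1` (clipped at `0`). [this work] -/
def NrX (κ : Consts) {V : Type} [DecidableEq V] [Countable V] {G : SimpleGraph V} [G.LocallyFinite] (Φ : PlanarSkeletonFrm G) (t : V) (p : unitInterval) (D : Skelφ.StepI.DataNS V) (g : ℕ) (f : ℕ) (P : PCells2T) (yL : Site 2) (σT : ℤ) (x : Site 2) (du : MDir) (z : Site 2) : ℕ :=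
  Int.toNat ((sgOf du * (T0X P x du z - FcA κ Φ t p D g f (yTX0 κ Φ t p D g f yL σT)) + u₀A κ Φ t p D g f / 2) / u₀A κ Φ t p D g f - 1)

/-- **`σ·T0X = 20·r₀ − lev`** for an x-direction `du` (`du.1 = 0`). [folklore] -/
theorem T0X_eq (P : PCells2T) (x : Site 2) (du : MDir) (hd : du.1 = 0) (z : Site 2) :
    sgOf du * T0X P x du z = 20 * (P.r 0 : ℤ) - P.lev du x z := by
  have hσ : sgOf du * sgOf du = 1 := by rcases sgOf_sign du with h | h <;> simp [h]
  have hc := PCells2T.cenS_add_stepVec_fst P x du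
  rw [hd] at hc
  unfold T0X PCells2T.lev
  rw [hd, hc]
  linear_combination (20 * (P.r 0 : ℤ)) * hσ

/-- **`T1X` SEES the along step through the creep**: `cenS (x + stepVec du) 1 = cenS x 1 + sgOf du · c 0` for `du.1 = 0` (N1's `cen_step_one` had no creep). [folklore] -/
theorem cenS_step_one (P : PCells2T) (x : Site 2) (du : MDir) (hd : du.1 = 0) :
    P.cenS (x + stepVec du) 1 = P.cenS x 1 + sgOf du * P.c 0 := by
  have h := PCells2T.cenS_add_stepVec_oth P x du
  rw [hd, show oth (0 : Fin 2) = 1 from rfl] at h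
  exact h

/-- **One `u`-stride adds exactly `u₀` to the along reading**: `FcA (y + k·(n_L, h_L)) = FcA y + k·u₀` (`Λ₀` gains `k·m`, `A` cancels). [folklore] -/
theorem FcA_add_stride (κ : Consts) {V : Type} [DecidableEq V] [Countable V] {G : SimpleGraph V} [G.LocallyFinite] (Φ : PlanarSkeletonFrm G) (t : V) (p : unitInterval) (D : Skelφ.StepI.DataNS V) (g : ℕ) (f : ℕ) (hN : EqNumL κ Φ t p D g f) (y : Site 2) (k : ℤ) :
    FcA κ Φ t p D g f (y + Skelφ.pt (k * nL κ Φ t p D g f) (k * hL κ Φ t p D g f)) = FcA κ Φ t p D g f y + k * u₀A κ Φ t p D g f := by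
  obtain ⟨hn1, hℓ1⟩ := one_le_of_eqNumL κ Φ t p D g f hN
  have hm : 0 < modulus (nL κ Φ t p D g f) (hL κ Φ t p D g f) (vL κ Φ t p D g f) (vβL κ Φ t p D g f) := Skelφ.NegPrm.modulus_vβOf_pos hn1 hℓ1 _ _
  rw [FcA_eq, FcA_eq]
  have hΛ : Λ₀of κ Φ t p D g f (y + Skelφ.pt (k * nL κ Φ t p D g f) (k * hL κ Φ t p D g f)) =
      Λ₀of κ Φ t p D g f y + k * modulus (nL κ Φ t p D g f) (hL κ Φ t p D g f) (vL κ Φ t p D g f) (vβL κ Φ t p D g f) := by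
    unfold Λ₀of vβL TwoAxis.Para.modulus
    simp only [Pi.add_apply, Skelφ.pt_zero, Skelφ.pt_one]
    ring
  rw [hΛ]
  set m := modulus (nL κ Φ t p D g f) (hL κ Φ t p D g f) (vL κ Φ t p D g f) (vβL κ Φ t p D g f)
  have e : 2 * u₀A κ Φ t p D g f * (Λ₀of κ Φ t p D g f y + k * m) + m = 2 * u₀A κ Φ t p D g f * Λ₀of κ Φ t p D g f y + m + k * u₀A κ Φ t p D g f * (2 * m) := by ring
  rw [e, Int.add_mul_ediv_right _ _ (by linarith)]

/-- `crossOffX` splits into the zero-stride cross shift and `(Nr+1)` signed strides. [folklore] -/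
theorem crossOffX_eq (κ : Consts) {V : Type} [DecidableEq V] [Countable V] {G : SimpleGraph V} [G.LocallyFinite] (Φ : PlanarSkeletonFrm G) (t : V) (p : unitInterval) (D : Skelφ.StepI.DataNS V) (g : ℕ) (f : ℕ) (yL : Site 2) (σ σT : ℤ) (Nr : ℕ) :
    yL + Skelφ.crossOffX (nL κ Φ t p D g f) (hL κ Φ t p D g f) (vL κ Φ t p D g f) σ σT Nr =
      yTX0 κ Φ t p D g f yL σT + Skelφ.pt ((σ * ((Nr : ℤ) + 1)) * nL κ Φ t p D g f) ((σ * ((Nr : ℤ) + 1)) * hL κ Φ t p D g f) := by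
  unfold yTX0 Skelφ.crossOffX
  funext i
  simp only [Pi.add_apply]
  fin_cases i <;> simp [Skelφ.pt] <;> ring

/-- **THE EXACT SHIFT**: the tangential origin's along reading is the cross-shifted origin's plus `σ·u₀·(Nr+1)`. [folklore] -/
theorem FcA_crossOffX (κ : Consts) {V : Type} [DecidableEq V] [Countable V] {G : SimpleGraph V} [G.LocallyFinite] (Φ : PlanarSkeletonFrm G) (t : V) (p : unitInterval) (D : Skelφ.StepI.DataNS V) (g : ℕ) (f : ℕ) (hN : EqNumL κ Φ t p D g f) (yL : Site 2) (σ σT : ℤ) (Nr : ℕ) :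
    FcA κ Φ t p D g f (yL + Skelφ.crossOffX (nL κ Φ t p D g f) (hL κ Φ t p D g f) (vL κ Φ t p D g f) σ σT Nr) =
      FcA κ Φ t p D g f (yTX0 κ Φ t p D g f yL σT) + σ * u₀A κ Φ t p D g f * ((Nr : ℤ) + 1) := by
  rw [crossOffX_eq, FcA_add_stride κ Φ t p D g f hN]; ring

export PlanarSkeletonNeg.NegB.KS (round_count)

/-- **The tangential choice is admissible**: `σTX = ±1`; `u₁·(N3X+1) ≤ |T1X − F1cA yL| + 2u₁`; and the tangential run ends within one `v`-stride
of the target, `|F1cA yL + σTX·u₁·(N3X+1) − T1X| ≤ u₁` (when the target is at least one stride away; else `N3X = 0` and the error is `< 2u₁`).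
[folklore] -/
theorem N3X_spec (κ : Consts) {V : Type} [DecidableEq V] [Countable V] {G : SimpleGraph V} [G.LocallyFinite] (Φ : PlanarSkeletonFrm G) (t : V) (p : unitInterval) (D : Skelφ.StepI.DataNS V) (g : ℕ) (f : ℕ) (P : PCells2T) (yL x : Site 2) (du : MDir) (z : Site 2) :
    (σTX κ Φ t p D g f P yL x du z = 1 ∨ σTX κ Φ t p D g f P yL x du z = -1) ∧
      u₁A κ Φ t p D g f * ((N3X κ Φ t p D g f P yL x du z : ℤ) + 1) ≤ |T1X P x du z - F1cA κ Φ t p D g f yL| + 2 * u₁A κ Φ t p D g f ∧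
      |F1cA κ Φ t p D g f yL + σTX κ Φ t p D g f P yL x du z * u₁A κ Φ t p D g f * ((N3X κ Φ t p D g f P yL x du z : ℤ) + 1) - T1X P x du z| ≤
        2 * u₁A κ Φ t p D g f := by
  have hu : 1 ≤ u₁A κ Φ t p D g f := (units_eqA κ Φ t p D g f).2.2.2.2.2
  set u := u₁A κ Φ t p D g f
  set T := T1X P x du z
  set F := F1cA κ Φ t p D g f yL
  have hσ : σTX κ Φ t p D g f P yL x du z = 1 ∨ σTX κ Φ t p D g f P yL x du z = -1 := by unfold σTX; split_ifs <;> simp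
  refine ⟨hσ, ?_⟩
  obtain ⟨d1, d2⟩ := PlanarSkeletonNeg.NegB.RootArith.floor_sandwich (x := u) (d := 2) (by norm_num)
  by_cases hfar : u ≤ |T - F|
  · obtain ⟨r1, r2⟩ := round_count (X := |T - F|) (by linarith) hfar
    have hN : (N3X κ Φ t p D g f P yL x du z : ℤ) = ((Int.toNat ((|T - F| + u / 2) / u - 1) : ℕ) : ℤ) := rfl
    rw [hN]
    refine ⟨by linarith, ?_⟩
    set M : ℤ := ((Int.toNat ((|T - F| + u / 2) / u - 1) : ℕ) : ℤ)
    obtain ⟨a1, a2⟩ := abs_le.1 r1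
    unfold σTX
    split_ifs with hle
    · rw [abs_of_nonneg (by linarith : (0:ℤ) ≤ T - F)] at a1 a2
      rw [abs_le]; constructor <;> linarith
    · push Not at hle
      rw [abs_of_neg (by linarith : T - F < 0)] at a1 a2
      rw [abs_le]; constructor <;> linarith
  · -- the target is within one stride: the count is `0`
    push Not at hfar
    obtain ⟨x1, x2⟩ := PlanarSkeletonNeg.NegB.RootArith.floor_sandwich (x := |T - F| + u / 2) (d := u) (by linarith)
    have hY : (|T - F| + u / 2) / u - 1 ≤ 0 := by
      by_contra hc; push Not at hc
      have : u * 2 ≤ u * ((|T - F| + u / 2) / u) := mul_le_mul_of_nonneg_left (by linarith) (by linarith)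
      linarith [abs_nonneg (T - F)]
    have hN : (N3X κ Φ t p D g f P yL x du z : ℤ) = 0 := by
      show ((Int.toNat ((|T - F| + u / 2) / u - 1) : ℕ) : ℤ) = 0
      rw [Int.toNat_of_nonpos hY]; rfl
    rw [hN, zero_add, mul_one]
    refine ⟨by linarith [abs_nonneg (T - F)], ?_⟩
    have hab := abs_le.1 (le_of_lt hfar)
    rcases hσ with h | h <;> rw [h] <;> rw [abs_le] <;> constructor <;> linarith

/-- **The along choice is admissible** (target at least one stride ahead of the cross-shifted origin): the x-run's end reading is within one
stride of the arrival target and the count is bounded by the distance. [cite: KozmaNitzan2024, §4 Lemma 11 (p. 22)] -/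
theorem NrX_spec (κ : Consts) {V : Type} [DecidableEq V] [Countable V] {G : SimpleGraph V} [G.LocallyFinite] (Φ : PlanarSkeletonFrm G) (t : V) (p : unitInterval) (D : Skelφ.StepI.DataNS V) (g : ℕ) (f : ℕ) (P : PCells2T) (hN : EqNumL κ Φ t p D g f) (yL : Site 2) (σT : ℤ) (x : Site 2) (du : MDir) (z : Site 2)
    (hX : u₀A κ Φ t p D g f ≤ sgOf du * (T0X P x du z - FcA κ Φ t p D g f (yTX0 κ Φ t p D g f yL σT))) :
    |FcA κ Φ t p D g f (yL + Skelφ.crossOffX (nL κ Φ t p D g f) (hL κ Φ t p D g f) (vL κ Φ t p D g f) (sgOf du) σT (NrX κ Φ t p D g f P yL σT x du z)) -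
        T0X P x du z| ≤ u₀A κ Φ t p D g f ∧
      u₀A κ Φ t p D g f * ((NrX κ Φ t p D g f P yL σT x du z : ℤ) + 1) ≤
        sgOf du * (T0X P x du z - FcA κ Φ t p D g f (yTX0 κ Φ t p D g f yL σT)) + u₀A κ Φ t p D g f := by
  have hu : 1 ≤ u₀A κ Φ t p D g f := (units_eqA κ Φ t p D g f).2.2.2.2.1
  have hσ : sgOf du = 1 ∨ sgOf du = -1 := sgOf_sign du
  rw [FcA_crossOffX κ Φ t p D g f hN]
  set u := u₀A κ Φ t p D g f
  set T := T0X P x du z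
  set F := FcA κ Φ t p D g f (yTX0 κ Φ t p D g f yL σT)
  obtain ⟨r1, r2⟩ := round_count (X := sgOf du * (T - F)) (by linarith) hX
  have hNr : (NrX κ Φ t p D g f P yL σT x du z : ℤ) = ((Int.toNat ((sgOf du * (T - F) + u / 2) / u - 1) : ℕ) : ℤ) := rfl
  rw [hNr]
  refine ⟨?_, r2⟩
  set M : ℤ := ((Int.toNat ((sgOf du * (T - F) + u / 2) / u - 1) : ℕ) : ℤ)
  obtain ⟨a1, a2⟩ := abs_le.1 r1
  rcases hσ with h | h <;> rw [h] at a1 a2 ⊢ <;> rw [abs_le] <;> constructor <;> linarith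

end FaceCounts

end KS

end NegB

end PlanarSkeletonFrm

end Summit.CriticalPhenomena.PercolationContinuityZ3.Theorems.Transplant

end
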